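import Summits.Ventures.CertifiedManyBodySolver.Downfold.WorkedExamplePassDome

/-!
# The §14 worked-example PASS criteria, part 3: PASS-TV2 STAGE 1 under the La-214 RE-ROUTE of record (v1.9)

Venture CertifiedManyBodySolver, cell `pub/hubbard-downfold`, seat hubbard-downfold-score-2 (session g7,
2026-08-27T03:3xZ); namespace `Summit.Ventures.CertifiedManyBodySolver.Downfold.WorkedExample` (continues
`WorkedExamplePassDome.lean`, p480856). Everything here is PROVED and finite; nothing is about a material.

WHAT THIS IS NOT: not the scorer of record (deputy-2 `score.py` v1.8 90fa3153c4e6faab), not a router ruling, not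
physics. It is the kernel reference for ONE pre-registered expectation (`validation/score/PREREG.md` Y62 (3) /
scoring event E30): the downfold lead's FLAGGED EVENT of 2026-08-27T03:12:10Z re-words the six LSCO-family inputs
of §14 worked example 2 (M13–M17, M50) from «1BH+3BE(+CI)» (router AGREE ×6) to «UND:MIXED+1BH+3BE+EPH(+CI)»
(router PARTIAL ×6, §4.2: foreign primary with the expected primary carried). STAGE 1 of PASS-TV2 reads the router
outcome of each input (`Input.stage1ok`), so on the first assembly whose maps carry the v1.9 words it flips
PASS → FAIL — `stage1_afterReroute`; it already FAILS if ONE of the six is re-worded (`stage1_m13_only`); and it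
returns to PASS exactly when all six read AGREE again (`stage1_restore`), which is what an adopted A10 treatment
re-routing the family to «1BH+3BE(+CI)» would do — whether one is adopted is decided on the Y37 hold-out cells
(`RouterScore.recommend`), not here.
-/

namespace Summit.Ventures.CertifiedManyBodySolver.Downfold

namespace WorkedExample

/-- an input with its router outcome replaced (everything else as delivered). [folklore] -/
def Input.withRouter (i : Input) (o : RouterScore.Outcome) : Input := { i with router := o }

/-- replacing the router outcome by AGREE on a W-clean, delivered, H-clean input makes it pass `stage1ok`;
by anything else makes it fail. [folklore] -/
theorem Input.stage1ok_withRouter (i : Input) (o : RouterScore.Outcome) :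
    (i.withRouter o).stage1ok = (i.wellFormed && i.present && decide (o = RouterScore.Outcome.AGREE) &&
      decide (i.hard = 0)) := rfl

/-- the six inputs with EVERY router outcome replaced by `o`. [folklore] -/
def Six.mapRouter (s : Six) (o : RouterScore.Outcome) : Six :=
  ⟨s.m13.withRouter o, s.m14.withRouter o, s.m15.withRouter o, s.m16.withRouter o, s.m17.withRouter o,
    s.m50.withRouter o⟩

/-- THE RE-ROUTE OF RECORD (La2CuO4-family §OF-RECORD v1.9, WORDS.tsv 03:11:55Z): today's six inputs with router
PARTIAL on all six (W-clean, delivered, 0 H, kinds TN / ABSTAIN ×5 unchanged). [folklore] -/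
def sixAfterReroute : Six := sixToday.mapRouter .PARTIAL

/-- PASS-TV2 STAGE 1 FAILS on the re-routed family (PREREG Y62 (3); regression expectation for the first assembly
carrying v1.9). [folklore] -/
theorem stage1_afterReroute : stage1 sixAfterReroute = .FAIL := by decide

/-- … and it already fails if only M13 is re-worded (one PARTIAL among six AGREE). [folklore] -/
theorem stage1_m13_only : stage1 { sixToday with m13 := sixToday.m13.withRouter .PARTIAL } = .FAIL := by
  decide

/-- a DISAGREE anywhere fails the same way (the clause reads «AGREE», not «not DISAGREE»). [folklore] -/
theorem stage1_disagree_m15 : stage1 { sixToday with m15 := sixToday.m15.withRouter .DISAGREE } = .FAIL := by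
  decide

/-- RESTORATION: re-routing all six back to AGREE (what an ADOPTED (α)/(β) treatment printing «1BH+3BE(+CI)» on
the family would do under ROUTER §7(3)) returns STAGE 1 to PASS; on today's inputs this is literally `sixToday`.
[folklore] -/
theorem stage1_restore : sixAfterReroute.mapRouter .AGREE = sixToday ∧
    stage1 (sixAfterReroute.mapRouter .AGREE) = .PASS :=
  ⟨rfl, by decide⟩

/-- In general: STAGE 1 passes on `s.mapRouter AGREE` iff every input is W-clean, delivered and H-clean — the
router clause is then discharged identically. [folklore] -/
theorem stage1_mapRouter_AGREE_iff (s : Six) : stage1 (s.mapRouter .AGREE) = .PASS ↔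
    ∀ i ∈ s.toList, i.wellFormed = true ∧ i.present = true ∧ i.hard = 0 := by
  rw [stage1_eq_PASS_iff']
  simp [Six.mapRouter, Six.toList, Input.withRouter]

/-- … and on `s.mapRouter o` with `o ≠ AGREE` it FAILS whatever the inputs. [folklore] -/
theorem stage1_mapRouter_ne (s : Six) {o : RouterScore.Outcome} (h : o ≠ .AGREE) :
    stage1 (s.mapRouter o) = .FAIL :=
  stage1_eq_FAIL_of_router_ne (i := s.m13.withRouter o) (by simp [Six.mapRouter, Six.toList]) (by simpa [Input.withRouter] using h)

end WorkedExample

end Summit.Ventures.CertifiedManyBodySolver.Downfold
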